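import Summits.ValiantsHypothesis.ValiantsHypothesis.Theorems.VPBoundarySquareNbCollapseIff
import HarnessLib

/-!
# The binomial table is the explicit necessary instance of `B_nb` (route `VPBoundarySquare`)

FILE 1 of O-L3-15 «BINOMIAL SLOT» (decomp-valiant lens 3, g40; aside `B_nb` = item 23487 =
`VNPnbPFamSubsetVNP ℂ`: every `VNPnb^ℂ` p-family is p-definable). The lineage's FILES 1a–1c / S2 /
S3a–S3b typed `B_nb` as ONE open statement with three kernel-equivalent class-level faces
(`B_nb ⟺ U_ε^Σ ⟺ NF_ℂ`) and localised the whole `{ERH, Bur24_thm_4_10_2}` debt of the square's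
P-side to the single arrow `VP = VNP → B_nb`. In print that arrow is a BOOLEAN collapse: Koiran–Perifel
2011 (Lemma 2, Lemma 4, Rem. 4) and Bürgisser 2024 (proof outline of Thm. 4.10) derive it from
`VP = VNP ⟹ CH/poly = P/poly` (the only GRH-dependent step) plus Valiant's criterion fed with the
bits of the coefficients of Malod's complete family — and those coefficients are, by Bürgisser 2024
(4.5)–(4.6), products of MULTINOMIAL COEFFICIENTS: «one faces the difficulty of coping with binomial
(or multinomial) coefficients, which have bitsize exponential in the bitsize of the integers»
(Bürgisser 2024, p0017). This file types that difficulty as ONE EXPLICIT P-FAMILY and proves it is a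
NECESSARY instance of `B_nb`:

* §1 `binomGen n := Π_{j<n} (1 + (t(1+x))^{2^j}) = Σ_{r<2^n} t^r (1+x)^r ∈ R[t, x]` — a `VPnb` object
  (repeated squaring, `complexity_binomGen_le`) whose coefficient of `t^r x^κ` is `r.choose κ`
  (`coeff_binomGen`);
* §2 the coefficient dictionary of bit-splitting (`coeff_indMon_bitSplit`: the coefficient of the
  multilinear monomial with bit pattern `b` in `bitSplit L p` is the coefficient of `x^{binVal b}` in `p`);
* §3 THE BINOMIAL TABLE `binomTable n := bitSplit n (binomGen ℂ n) = Σ_{r,κ ∈ {0,1}^n} C(val r, val κ)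
  · Π_{r_j=1} y_{0j} Π_{κ_j=1} y_{1j}` (`coeff_binomTable`), a multilinear p-family in `2n` variables lying
  in `VNPnb^ℂ` UNCONDITIONALLY (`isVNPnbFamily_binomTable`: the Fourier witness `splitSummand` of FILE 1b
  at `ω = exp(2πi/2^n)`, constants free);
* §4 **`B_nb → binomTable ∈ VNP^ℂ`** (`isVNPFamily_binomTable_of_booleanNbDefinable`);
* §5 the explicit-family SEPARATION CRITERIA: `binomTable ∉ VNP^ℂ → VPnb^ℂ ≠ VNPnb^ℂ` GRH-free
  (`not_nbCollapse_of_not_isVNPFamily_binomTable`, via FILE 1b), and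
  `ERH → Bur24_thm_4_10_2 ℂ → binomTable ∉ VNP^ℂ → VP ℂ ≠ VNP ℂ` = the summit
  (`valiantsHypothesis_of_ERH_of_not_isVNPFamily_binomTable`): to prove Valiant's hypothesis under GRH
  it suffices to show that ONE explicit family of 0/1-free integer multilinear polynomials — the table
  of binomial coefficients indexed in binary — is NOT p-DEFINABLE over `ℂ`.

Honest framing: §4 is the instance of a class statement; its content is the CHOICE of the instance —
the converse `binomTable ∈ VNP^ℂ → B_nb` (the binomial table is COMPLETE for the nb-question:
multinomials are products of binomials of partial sums, Malod's coefficient formula, power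
substitution, FILE S3b's `NF_ℂ → B_nb`) is staged as FILES 2–4 of the series and NOT proved here.
`B_nb`, `binomTable ∈ VNP^ℂ`, `VP ≠ VNP`, `VPnb ≠ VNPnb` all stay OPEN; nothing is constant-free
(Koiran–Perifel's GRH-free `VP⁰ = VNP⁰ ⟹ VPnb⁰ = VNPnb⁰` is about `τ`, untouched). 0 `Prop`
definitions, 0 named facts, 0 sorry; data definitions `binomGen`, `expo`, `indMon`, `valMon`, `binomTable`.

STATUS OF THE SLOT (critic CALL O-L3-15): `binomTable ∈ VNP^ℂ` is UNDECIDED as far as searched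
(Bürgisser 2024 p0017 L54–L60 states the binomial obstruction for the constant-free extension;
Koiran–Perifel 2011; Poizat 2014 *Malod and the Pascaline* unread, acquisition acq-15003). The
lineage's own interpolation does not decide it: writing `C(r,κ) = 2^{-n} Σ_{ω^{2^n}=1} Π_l (1 +
κ_l(ω^{-2^l} - 1)) Π_j (1 + r_j((1+ω)^{2^j} - 1))` and parametrising `ω(b) = Π_i ζ_i^{b_i}` over the
Boolean cube makes every factor multilinear in the bits EXCEPT `b ↦ (1+ω(b))^{2^j}`, which is exactly
the `VPnb` summand of §3 — the slot is «are these powers p-expressible (size AND degree) on the cube».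
It is constant- and characteristic-sensitive: over `𝔽₂` the same table is `Π_j (1 + t_j(1 + x_j)) ∈ VP`
(Lucas).

References: [Burgisser2024Completeness, §4.2 (4.5)–(4.6) (p0016 L78–L104), Rem. 4.9 / Thm. 4.10 with
proof outline (p0017 L44–L103, p0018 L1–L10)]; [BhargavDwivediSaxena2024, Lemma 4.1 (p. 13)];
[KoiranPerifel2011, Lemma 2, Lemma 4, Thm. 5, Rem. 4 (arXiv:0710.0360, held p0006–p0008)]; B. Poizat,
*Malod and the Pascaline*, Progr. Comput. Sci. Appl. Logic 26 (2014) 147–157 (prose only, acq-15003).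
-/

set_option linter.dupNamespace false

noncomputable section

open MvPolynomial Finset
open Literature.Computability.AlgebraicComplexity
open Literature.NumberTheory.LFunctions (ExtendedRiemannHypothesis)
open Summit.ValiantsHypothesis.ValiantsHypothesis.Theorems.VPBoundarySquareNbBitSplit
open Summit.ValiantsHypothesis.ValiantsHypothesis.Theorems.VPBoundarySquareNbGRHSlot
open Summit.ValiantsHypothesis.ValiantsHypothesis.Theorems.VPBoundarySquareNbCollapseIff

namespace Summit.ValiantsHypothesis.ValiantsHypothesis.Theorems.VPBoundarySquareNbBinomialTable

/-! ## §1 The binomial generating polynomial `Π_{j<n} (1 + (t(1+x))^{2^j})` -/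

section Gen

variable (R : Type*) [CommSemiring R]

/-- `binomGen n = Π_{j<n} (1 + (t·(1+x))^{2^j}) ∈ R[t, x]` (`t = X 0`, `x = X 1`): `n` repeated
squarings generate all `2^n` rows of Pascal's triangle. [cite: Burgisser2024Completeness, Rem. 4.9 / Thm. 4.10 (p0017 L55–L56)] -/
def binomGen (n : ℕ) : MvPolynomial (Fin 2) R :=
  ∏ j : Fin n, (1 + (X 0 * (1 + X 1)) ^ 2 ^ (j : ℕ))

/-- The exponent vector of `t^r x^m`. [folklore] -/
def expo (r m : ℕ) : Fin 2 →₀ ℕ := Finsupp.single 0 r + Finsupp.single 1 m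

/-- The `t`-exponent of `expo r m` is `r`. [folklore] -/
@[simp] theorem expo_zero (r m : ℕ) : expo r m 0 = r := by simp [expo]

/-- The `x`-exponent of `expo r m` is `m`. [folklore] -/
@[simp] theorem expo_one (r m : ℕ) : expo r m 1 = m := by simp [expo]

/-- `expo r m = d ↔ r = d 0 ∧ m = d 1`. [folklore] -/
theorem expo_eq_iff (r m : ℕ) (d : Fin 2 →₀ ℕ) : expo r m = d ↔ r = d 0 ∧ m = d 1 := by
  constructor
  · rintro rfl; simp
  · rintro ⟨hr, hm⟩
    ext i
    fin_cases i
    · simpa using hr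
    · simpa using hm

/-- `binomGen n = Σ_{r<2^n} (t(1+x))^r` (the geometric product `Π_j (1+ξ^{2^j}) = Σ_{r<2^n} ξ^r`).
[cite: Burgisser2024Completeness, Thm. 4.8 (p0017)] -/
theorem binomGen_eq_sum (n : ℕ) :
    binomGen R n = ∑ r ∈ range (2 ^ n), (X 0 * (1 + X 1) : MvPolynomial (Fin 2) R) ^ r :=
  prod_one_add_pow_two_pow _ n

/-- The binomial theorem, monomially: `(t(1+x))^r = Σ_{m ≤ r} C(r,m) · t^r x^m`. [folklore] -/
theorem pow_tx_eq_sum (r : ℕ) :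
    (X 0 * (1 + X 1) : MvPolynomial (Fin 2) R) ^ r =
      ∑ m ∈ range (r + 1), monomial (expo r m) (r.choose m : R) := by
  rw [mul_pow, add_comm, add_pow, mul_sum]
  refine sum_congr rfl fun m _ => ?_
  rw [one_pow, mul_one, X_pow_eq_monomial, X_pow_eq_monomial, ← map_natCast (C : R →+* _), C_apply,
    monomial_mul, monomial_mul]
  simp only [add_zero, one_mul, expo]

/-- **The coefficients of `binomGen` are the binomial coefficients**: the coefficient of `t^{d₀} x^{d₁}`
is `C(d₀, d₁)` for `d₀ < 2^n` and `0` beyond. [cite: Burgisser2024Completeness, Rem. 4.9 (p0017 L55–L56)] -/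
theorem coeff_binomGen (n : ℕ) (d : Fin 2 →₀ ℕ) :
    coeff d (binomGen R n) = if d 0 < 2 ^ n then ((d 0).choose (d 1) : R) else 0 := by
  rw [binomGen_eq_sum]
  simp_rw [pow_tx_eq_sum, coeff_sum, coeff_monomial, expo_eq_iff]
  by_cases h0 : d 0 < 2 ^ n
  · rw [if_pos h0, sum_eq_single_of_mem (d 0) (mem_range.2 h0) fun r _ hr => ?_]
    · simp only [true_and]
      rw [sum_ite_eq' (range (d 0 + 1)) (d 1) fun m => ((d 0).choose m : R)]
      split_ifs with h1
      · rfl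
      · rw [Nat.choose_eq_zero_of_lt (by simpa [mem_range, Nat.lt_succ_iff] using h1), Nat.cast_zero]
    · exact sum_eq_zero fun m _ => if_neg fun h => hr h.1
  · rw [if_neg h0]
    exact sum_eq_zero fun r hr => sum_eq_zero fun m _ => if_neg fun h : r = d 0 ∧ m = d 1 =>
      h0 (h.1 ▸ mem_range.1 hr)

/-- `deg_t binomGen n < 2^n` and `deg_x binomGen n < 2^n`. [folklore] -/
theorem degreeOf_binomGen_lt (n : ℕ) (i : Fin 2) : (binomGen R n).degreeOf i < 2 ^ n := by
  rw [degreeOf_lt_iff (pow_pos (by norm_num) n)]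
  intro d hd
  have hc : coeff d (binomGen R n) ≠ 0 := mem_support_iff.1 hd
  rw [coeff_binomGen] at hc
  have h0 : d 0 < 2 ^ n := by by_contra h; exact hc (if_neg h)
  rw [if_pos h0] at hc
  have h1 : d 1 ≤ d 0 := by
    by_contra h
    exact hc (by rw [Nat.choose_eq_zero_of_lt (not_le.1 h), Nat.cast_zero])
  fin_cases i
  · exact h0
  · exact lt_of_le_of_lt h1 h0

/-- Repeated squaring: `L(p^{2^j}) ≤ L(p) + j`. [cite: Burgisser2000, §2.1] -/
theorem complexity_pow_two_pow_le {σ : Type*} (p : MvPolynomial σ R) :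
    ∀ j : ℕ, complexity (p ^ 2 ^ j) ≤ complexity p + j
  | 0 => by simp
  | j + 1 => by
    have h : p ^ 2 ^ (j + 1) = aeval (fun _ : Unit => p ^ 2 ^ j) (X () * X () : MvPolynomial Unit R) := by
      rw [map_mul, aeval_X, pow_succ, pow_mul, sq]
    rw [h]
    refine (complexity_aeval_le _ _).trans ?_
    have h1 : complexity (X () * X () : MvPolynomial Unit R) ≤ 1 :=
      (complexity_mul_le_holds _ _).trans (by rw [complexity_X_holds (k := R)])
    rw [Fintype.sum_unique]
    have := complexity_pow_two_pow_le p j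
    omega

/-- `L(binomGen n) ≤ n (n + 4) + n`: the generating polynomial is a `VPnb` object (unbounded degree
`2 · (2^n - 1)`, polynomial size). [cite: Burgisser2024Completeness, §4.2 (p0016 L8–L11)] -/
theorem complexity_binomGen_le (n : ℕ) : complexity (binomGen R n) ≤ n * (n + 4) + n := by
  unfold binomGen
  refine (complexity_finset_prod_le _ _).trans ?_
  rw [card_univ, Fintype.card_fin]
  refine Nat.add_le_add_right ?_ n
  have hbase : complexity (X 0 * (1 + X 1) : MvPolynomial (Fin 2) R) ≤ 2 := by
    refine (complexity_mul_le_holds _ _).trans ?_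
    have h1 : complexity (1 + X 1 : MvPolynomial (Fin 2) R) ≤ 1 := by
      refine (complexity_add_le_holds _ _).trans ?_
      rw [← C_1, complexity_C_holds (k := R), complexity_X_holds (k := R)]
    rw [complexity_X_holds (k := R)]
    omega
  calc ∑ j : Fin n, complexity (1 + (X 0 * (1 + X 1) : MvPolynomial (Fin 2) R) ^ 2 ^ (j : ℕ))
      ≤ ∑ _j : Fin n, (n + 4) := sum_le_sum fun j _ => by
        refine (complexity_add_le_holds _ _).trans ?_
        have h1c : complexity (1 : MvPolynomial (Fin 2) R) = 0 := by
          rw [← C_1, complexity_C_holds (k := R)]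
        have := complexity_pow_two_pow_le R (X 0 * (1 + X 1) : MvPolynomial (Fin 2) R) j
        have hj := j.isLt
        rw [h1c]
        omega
    _ = n * (n + 4) := by rw [sum_const, card_univ, Fintype.card_fin, smul_eq_mul]

end Gen

/-! ## §2 The coefficient dictionary of bit-splitting -/

section Split

variable {F : Type*} [Field F] {σ : Type*} [Fintype σ]

/-- The multilinear exponent vector with support `{x : b x}`. [folklore] -/
def indMon {τ : Type*} [Finite τ] (b : τ → Bool) : τ →₀ ℕ :=
  Finsupp.equivFunOnFinite.symm fun x => if b x then 1 else 0

/-- `indMon b x = [b x]`. [folklore] -/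
@[simp] theorem indMon_apply {τ : Type*} [Finite τ] (b : τ → Bool) (x : τ) :
    indMon b x = if b x then 1 else 0 := by simp [indMon]

/-- The exponent vector `i ↦ binVal (b (i, ·))` decoded from a bit pattern `b`. [folklore] -/
def valMon {L : ℕ} (b : σ × Fin L → Bool) : σ →₀ ℕ :=
  Finsupp.equivFunOnFinite.symm fun i => binVal fun j : Fin L => b (i, j)

/-- `valMon b i = binVal (b (i, ·))`. [folklore] -/
@[simp] theorem valMon_apply {L : ℕ} (b : σ × Fin L → Bool) (i : σ) :
    valMon b i = binVal fun j : Fin L => b (i, j) := by simp [valMon]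

/-- The selector product of a bit pattern is the multilinear monomial it indicates. [folklore] -/
theorem prod_ite_X_eq_monomial {L : ℕ} (b : σ × Fin L → Bool) :
    (∏ i : σ, ∏ j : Fin L, (if b (i, j) then X (i, j) else 1 : MvPolynomial (σ × Fin L) F)) =
      monomial (indMon b) 1 := by
  rw [monomial_eq, C_1, one_mul, Finsupp.prod_fintype _ _ fun _ => pow_zero _, Fintype.prod_prod_type]
  refine prod_congr rfl fun i _ => prod_congr rfl fun j _ => ?_
  rw [indMon_apply]
  split_ifs <;> simp

/-- `bitSplit` as a sum of multilinear monomials. [cite: Burgisser2024Completeness, Thm. 4.8 (p0017)] -/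
theorem bitSplit_eq_sum_monomial (L : ℕ) (p : MvPolynomial σ F) :
    bitSplit L p = ∑ m ∈ p.support,
      monomial (indMon fun x : σ × Fin L => (m x.1).testBit x.2) (coeff m p) := by
  unfold bitSplit
  refine sum_congr rfl fun m _ => ?_
  rw [prod_ite_X_eq_monomial (fun x : σ × Fin L => (m x.1).testBit x.2), C_mul_monomial, mul_one]

/-- Bit patterns below `2^L` decode injectively: the bits of `m` are `b` iff `m = valMon b`
(for `m i < 2^L`). [folklore] -/
theorem indMon_testBit_eq_iff {L : ℕ} {m : σ →₀ ℕ} (hm : ∀ i, m i < 2 ^ L) (b : σ × Fin L → Bool) :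
    (indMon fun x : σ × Fin L => (m x.1).testBit x.2) = indMon b ↔ m = valMon b := by
  constructor
  · intro h
    ext i
    rw [valMon_apply]
    have hb : (fun j : Fin L => b (i, j)) = fun j : Fin L => (m i).testBit j := by
      funext j
      have hx := congrArg (fun f : (σ × Fin L) →₀ ℕ => f (i, j)) h
      simp only [indMon_apply] at hx
      cases hmt : (m i).testBit j <;> cases hbt : b (i, j) <;> simp [hmt, hbt] at hx ⊢
    rw [hb, binVal_testBit (hm i)]
  · rintro rfl
    congr 1
    funext x
    rw [valMon_apply, testBit_binVal]

/-- **Coefficient dictionary**: if `deg_{x_i} p < 2^L` for all `i`, the coefficient in `bitSplit L p`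
of the multilinear monomial with bit pattern `b` is the coefficient of `Π_i x_i^{binVal b(i,·)}` in `p`.
[cite: Burgisser2024Completeness, Thm. 4.8 / Rem. 4.9 (p0017)] -/
theorem coeff_indMon_bitSplit (L : ℕ) (p : MvPolynomial σ F) (hdeg : ∀ i, p.degreeOf i < 2 ^ L)
    (b : σ × Fin L → Bool) : coeff (indMon b) (bitSplit L p) = coeff (valMon b) p := by
  classical
  rw [bitSplit_eq_sum_monomial, coeff_sum]
  simp_rw [coeff_monomial]
  by_cases hs : valMon b ∈ p.support
  · rw [sum_eq_single_of_mem (valMon b) hs fun m hm hne => ?_,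
      if_pos ((indMon_testBit_eq_iff (fun i => (monomial_le_degreeOf i hs).trans_lt (hdeg i)) b).2 rfl)]
    exact if_neg fun h =>
      hne ((indMon_testBit_eq_iff (fun i => (monomial_le_degreeOf i hm).trans_lt (hdeg i)) b).1 h)
  · rw [notMem_support_iff.1 hs]
    exact sum_eq_zero fun m hm => if_neg fun h =>
      hs (((indMon_testBit_eq_iff (fun i => (monomial_le_degreeOf i hm).trans_lt (hdeg i)) b).1 h) ▸ hm)

end Split

/-! ## §3 The binomial table: an explicit multilinear p-family in `VNPnb^ℂ` -/

section Table

/-- **THE BINOMIAL TABLE** `binomTable n ∈ ℂ[y_{0j}, y_{1j} : j < n]`: the bit-split of `binomGen ℂ n`,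
i.e. `Σ_{r, κ ∈ {0,1}^n} C(val r, val κ) Π_{j : r_j = 1} y_{0j} Π_{j : κ_j = 1} y_{1j}`. [cite: Burgisser2024Completeness, Rem. 4.9 / Thm. 4.10 (p0017 L55–L60)] -/
def binomTable (n : ℕ) : MvPolynomial (Fin 2 × Fin n) ℂ := bitSplit n (binomGen ℂ n)

/-- **Its coefficients are the binomial coefficients indexed in binary.** [cite: Burgisser2024Completeness, Rem. 4.9 (p0017 L55–L56)] -/
theorem coeff_binomTable (n : ℕ) (b : Fin 2 × Fin n → Bool) :
    coeff (indMon b) (binomTable n) =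
      ((binVal fun j : Fin n => b (0, j)).choose (binVal fun j : Fin n => b (1, j)) : ℂ) := by
  rw [binomTable, coeff_indMon_bitSplit n _ (degreeOf_binomGen_lt ℂ n) b, coeff_binomGen,
    valMon_apply, valMon_apply, if_pos (binVal_lt_two_pow _)]

/-- The table is multilinear: `deg binomTable n ≤ 2n`. [folklore] -/
theorem totalDegree_binomTable_le (n : ℕ) : (binomTable n).totalDegree ≤ 2 * n := by
  unfold binomTable
  simpa using totalDegree_bitSplit_le n (binomGen ℂ n)

/-- `binomTable` is a p-family (`2n` variables, degree `≤ 2n`). [cite: Burgisser2000, Def. 2.3] -/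
theorem isPFamily_binomTable : IsPFamily (σ := fun n => Fin 2 × Fin n) binomTable := by
  have h2 : IsPBounded fun n => 2 * n := IsPBounded.mul_holds (IsPBounded.const 2) IsPBounded.id
  refine ⟨h2.mono fun n => by simp, h2.mono totalDegree_binomTable_le⟩

/-- The empty Boolean sum of `p` (renamed into `σ ⊕ Fin 0`) is `p`. [folklore] -/
theorem boolSum_rename_inl_zero {F : Type*} [CommSemiring F] {σ : Type*} (p : MvPolynomial σ F) :
    boolSum (rename Sum.inl p : MvPolynomial (σ ⊕ Fin 0) F) = p := by
  unfold boolSum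
  rw [Fintype.sum_unique, aeval_rename, Sum.elim_comp_inl, aeval_X_left]
  exact AlgHom.id_apply (R := F) p

/-- **`binomTable ∈ VNPnb^ℂ` unconditionally**: it is the Boolean sum of FILE 1b's Fourier witness
`splitSummand n ω (binomGen)` at `ω = exp(2πi/2^n)` (BDS 2024 Lemma 4.1's interpolation over `ℂ`,
constants free), whose size is polynomial since `L(binomGen n) = O(n²)`. [cite: BhargavDwivediSaxena2024, Lemma 4.1 (p. 13)] -/
theorem isVNPnbFamily_binomTable : IsVNPnbFamily (σ := fun n => Fin 2 × Fin n) binomTable := by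
  let ω : ℕ → ℂ := fun n => Complex.exp (2 * Real.pi * Complex.I / ((2 ^ n : ℕ) : ℂ))
  have hω : ∀ n, IsPrimitiveRoot (ω n) (2 ^ n) := fun n =>
    Complex.isPrimitiveRoot_exp (2 ^ n) (pow_ne_zero n two_ne_zero)
  have hdeg : ∀ n i, (boolSum (rename Sum.inl (binomGen ℂ n) : MvPolynomial (Fin 2 ⊕ Fin 0) ℂ)).degreeOf i
      < 2 ^ n := fun n i => by
    rw [boolSum_rename_inl_zero]; exact degreeOf_binomGen_lt ℂ n i
  refine ⟨fun n => Fintype.card (Fin 2) * n + 0,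
    fun n => splitSummand n (ω n) (rename Sum.inl (binomGen ℂ n) : MvPolynomial (Fin 2 ⊕ Fin 0) ℂ),
    (isVPnbFamily_iff_isPComputable _).2 ⟨?_, ?_⟩, fun n => ?_⟩
  · have h4 : IsPBounded fun n => 4 * n := IsPBounded.mul_holds (IsPBounded.const 4) IsPBounded.id
    exact h4.mono fun n => by simp; omega
  · have hid := IsPBounded.id
    have hL : IsPBounded fun n => (n * (n + 4) + n) + Fintype.card (Fin 2) * (3 * n) +
        (Fintype.card (Fin 2) * (n * (3 * n + 2) + n) + Fintype.card (Fin 2)) + 2 := by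
      simp only [Fintype.card_fin]
      apply_rules [IsPBounded.add_holds, IsPBounded.mul_holds, IsPBounded.const]
    refine hL.mono fun n => (complexity_splitSummand_le n (ω n) _).trans ?_
    have h := (complexity_rename_le_holds' (Sum.inl : Fin 2 → Fin 2 ⊕ Fin 0) (binomGen ℂ n)).trans
      (complexity_binomGen_le ℂ n)
    omega
  · show binomTable n = boolSum (splitSummand n (ω n) (rename Sum.inl (binomGen ℂ n)))
    rw [boolSum_splitSummand n (hω n) _ (hdeg n), boolSum_rename_inl_zero]
    rfl

/-! ## §4 `B_nb` forces the binomial table into `VNP^ℂ` -/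

/-- **`B_nb → binomTable ∈ VNP^ℂ`.** Rename to `Fin (2n)` (`finProdFinEquiv`), apply `B_nb` to the
`VNPnb^ℂ` p-family of §3, rename back. The binomial table — Bürgisser's «difficulty of coping with
binomial coefficients» — is thus a NECESSARY instance of the Boolean-part slot `B_nb`. [cite: Burgisser2024Completeness, Rem. 4.9 / Thm. 4.10 (2) (p0017 L55–L75)] -/
theorem isVNPFamily_binomTable_of_booleanNbDefinable (hB : VNPnbPFamSubsetVNP ℂ) :
    IsVNPFamily (σ := fun n => Fin 2 × Fin n) binomTable := by
  let e : ∀ n : ℕ, Fin 2 × Fin n ≃ Fin (2 * n) := fun n => finProdFinEquiv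
  have h := hB (fun n => 2 * n) (fun n => renameEquiv ℂ (e n) (binomTable n))
    ((isPFamily_renameEquiv_iff e _).2 isPFamily_binomTable)
    (isVNPnbFamily_renameEquiv e isVNPnbFamily_binomTable)
  exact (isVNPFamily_renameEquiv_iff e _).1 h

end Table

/-! ## §5 Explicit-family separation criteria -/

section Criteria

/-- **GRH-free criterion for the nb-classes**: if the binomial table is NOT p-definable over `ℂ`, then
`VNPnb^ℂ ⊄ VPnb^ℂ` (FILE 1b: `VNPnb^ℂ ⊆ VPnb^ℂ → B_nb`). [cite: Burgisser2024Completeness, Rem. 4.9 / Thm. 4.10 (2) (p0017)] -/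
theorem not_nbCollapse_of_not_isVNPFamily_binomTable
    (h : ¬ IsVNPFamily (σ := fun n => Fin 2 × Fin n) binomTable) :
    ¬ ∀ (v : ℕ → ℕ) (f : ∀ n, MvPolynomial (Fin (v n)) ℂ), IsVNPnbFamily f → IsVPnbFamily f :=
  fun hc => h (isVNPFamily_binomTable_of_booleanNbDefinable (booleanNbDefinable_of_nbCollapse hc))

/-- The same, as an existence statement: some `VNPnb^ℂ` family is not in `VPnb^ℂ`. [cite: Burgisser2024Completeness, Thm. 4.10 (2) (p0017)] -/
theorem exists_vnpnb_not_vpnb_of_not_isVNPFamily_binomTable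
    (h : ¬ IsVNPFamily (σ := fun n => Fin 2 × Fin n) binomTable) :
    ∃ (v : ℕ → ℕ) (f : ∀ n, MvPolynomial (Fin (v n)) ℂ), IsVNPnbFamily f ∧ ¬ IsVPnbFamily f := by
  have h' := not_nbCollapse_of_not_isVNPFamily_binomTable h
  push Not at h'
  exact h'

/-- **Criterion for the summit under GRH**: with Bürgisser 2024 Thm. 4.10 (2) (named fact, GRH),
`VP ℂ = VNP ℂ` would collapse the nb-classes (FILE 1b's GRH-slot), so a proof that the binomial table
is not p-definable over `ℂ` proves `VP ℂ ≠ VNP ℂ`. [cite: Burgisser2024Completeness, Thm. 4.10 (2) (p0017)] -/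
theorem vp_ne_vnp_of_ERH_of_not_isVNPFamily_binomTable (hGRH : ExtendedRiemannHypothesis)
    (h410 : Bur24_thm_4_10_2 ℂ) (h : ¬ IsVNPFamily (σ := fun n => Fin 2 × Fin n) binomTable) :
    VP ℂ ≠ VNP ℂ :=
  fun hEq => not_nbCollapse_of_not_isVNPFamily_binomTable h (nbCollapse_of_ERH_of_collapse hGRH h410 hEq)

/-- The summit form of the criterion. [cite: Burgisser2024Completeness, Thm. 4.10 (2) (p0017)] -/
theorem valiantsHypothesis_of_ERH_of_not_isVNPFamily_binomTable (hGRH : ExtendedRiemannHypothesis)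
    (h410 : Bur24_thm_4_10_2 ℂ) (h : ¬ IsVNPFamily (σ := fun n => Fin 2 × Fin n) binomTable) :
    ValiantsHypothesis :=
  show VP ℂ ≠ VNP ℂ from vp_ne_vnp_of_ERH_of_not_isVNPFamily_binomTable hGRH h410 h

/-- Conversely to §4 nothing is claimed; but the table already sits in every class the lineage typed
BELOW `VNP^ℂ` on the U-ladder: it is a `VNPnb^ℂ` p-family (§3), so under `B_nb` it is in `VNP^ℂ` (§4)
and under `VNPnb^ℂ ⊆ VPnb^ℂ` even in `VP^ℂ` (a `VPnb` p-family is p-computable). [cite: Burgisser2024Completeness, Rem. 4.9 (p0017)] -/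
theorem isVPFamily_binomTable_of_nbCollapse
    (hc : ∀ (v : ℕ → ℕ) (f : ∀ n, MvPolynomial (Fin (v n)) ℂ), IsVNPnbFamily f → IsVPnbFamily f) :
    IsVPFamily (σ := fun n => Fin 2 × Fin n) binomTable := by
  let e : ∀ n : ℕ, Fin 2 × Fin n ≃ Fin (2 * n) := fun n => finProdFinEquiv
  have h := hc (fun n => 2 * n) (fun n => renameEquiv ℂ (e n) (binomTable n))
    (isVNPnbFamily_renameEquiv e isVNPnbFamily_binomTable)
  have hP : IsPFamily fun n => renameEquiv ℂ (e n) (binomTable n) :=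
    (isPFamily_renameEquiv_iff e _).2 isPFamily_binomTable
  exact (isVPFamily_renameEquiv_iff e _).1 ⟨hP, ((isVPnbFamily_iff_isPComputable _).1 h).2⟩

end Criteria

end Summit.ValiantsHypothesis.ValiantsHypothesis.Theorems.VPBoundarySquareNbBinomialTable

end
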